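import Literature.AlgebraicGeometry.Resolution.WeightedCentreInvariantDirection
import Literature.AlgebraicGeometry.Resolution.WeightedCentreSigmaRescaling
import HarnessLib

/-!
# LEMMA L core (a)(b): a line of translations along `Q·c` fixing `G` removes a variable (instrument, NOT a resolution theorem)

Engine 1 of the RESOLUTION OBSERVATORY toy model `W(f)` (RE-DERIVATION-eng1-g41 §3.7 "the GROUP TRICK", LEMMA L;
CARVER-NOTES-eng1-g41 T89 (a)(b)) needs: over a domain, if `G(X + t·Q·c) = G(X)` identically in `t`, where `c` is a CONSTANT
direction and `Q ≠ 0` a polynomial, then `c` is an invariant direction of `G` — so after an invertible linear change of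
coordinates with first basis vector `c` the first variable is ABSENT from `G` (`WeightedCentreInvariantDirection`).

The whole content is the factorisation `G(X + t·Q·c) = (G(X + s·c))|_{s := Q t}` (`polyShift_C_mul`: a shift along `Q·c` is the
constant shift along `c` followed by the rescaling `s ↦ Q s` of `WeightedCentreSigmaRescaling`), after which the `t^n`-coefficient
of the hypothesis reads `Q^n · h_n = 0` (`h_n` the `n`-th Taylor coefficient of `G` along `c`), and a domain cancels `Q^n`.
NOTE: no hypothesis "`X_i ∉ Q.vars`" is needed for the identity-in-`t` version.

* `PolyShift.polyShift v` — `F ↦ F(X + t·v(X)) ∈ K[X][t]` for a POLYNOMIAL direction field `v : ι → K[X]`; `polyShift_const`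
  (constant fields give `lineShift`), `polyShift_C_mul` (the factorisation), `polyShift_eq_C_of_isInvariantDir` (converse);
* `PolyShift.isInvariantDir_of_polyShift_C_mul` — T89 (a): `Q ≠ 0`, `G(X + tQc) = G` ⇒ `IsInvariantDir G c`;
  `isInvariantDir_iff_polyShift_C_mul`; `notMem_vars_of_polyShift_single` — the coordinate case `c = e_i`: `X_i ∉ G.vars`;
* `PolyShift.exists_linSubst_notMem_vars` — T89 (b): over a field, `c ≠ 0` invariant ⇒ an invertible linear substitution `A`
  with `i`-th column `c` has `X_i ∉ (G∘A).vars`; combined form `exists_linSubst_notMem_vars_of_polyShift`.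

References: Taylor expansion along a line / algebraic independence [Lang2002, Ch. IV §1]; the frame [AbramovichTemkinWlodarczyk2024,
Thm. 5.3.1].  All statements are OURS (toy-model bookkeeping).
-/

namespace Literature.AlgebraicGeometry.Resolution.WeightedBlowup

namespace PolyShift

open MvPolynomial InvariantDirection

variable {K : Type*} [CommRing K] {ι : Type*}

/-- `F ↦ F(X + t·v(X)) ∈ K[X][t]`: the shift of the generic point along a POLYNOMIAL direction field `v` (ours).
[cite: Lang2002, Ch. IV §1] -/
noncomputable def polyShift (v : ι → MvPolynomial ι K) : MvPolynomial ι K →ₐ[K] Polynomial (MvPolynomial ι K) :=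
  MvPolynomial.aeval fun j => Polynomial.C (X j) + Polynomial.X * Polynomial.C (v j)

/-- Plumbing (ours). [cite: Lang2002, Ch. IV §1] -/
@[simp] theorem polyShift_X (v : ι → MvPolynomial ι K) (j : ι) :
    polyShift v (X j : MvPolynomial ι K) = Polynomial.C (X j) + Polynomial.X * Polynomial.C (v j) := by
  simp [polyShift]

/-- Plumbing (ours). [cite: Lang2002, Ch. IV §1] -/
@[simp] theorem polyShift_C (v : ι → MvPolynomial ι K) (a : K) :
    polyShift v (C a : MvPolynomial ι K) = Polynomial.C (C a) := by
  simp [polyShift, Polynomial.algebraMap_apply, MvPolynomial.algebraMap_eq]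

/-- A CONSTANT direction field gives the constant shift `lineShift` of `WeightedCentreInvariantDirection` (ours).
[cite: Lang2002, Ch. IV §1] -/
theorem polyShift_const (c : ι → K) : polyShift (fun j => C (c j) : ι → MvPolynomial ι K) = lineShift c :=
  MvPolynomial.algHom_ext fun j => by rw [polyShift_X, lineShift_X]

/-- **The factorisation** (ours): `G(X + t·Q·c) = (G(X + s·c))|_{s := Q t}` — a shift along `Q·c` is the constant shift along `c`
followed by the rescaling `s ↦ Q s`. [cite: Lang2002, Ch. IV §1] -/
theorem polyShift_C_mul (c : ι → K) (Q : MvPolynomial ι K) (F : MvPolynomial ι K) :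
    polyShift (fun j => C (c j) * Q) F = sigmaScale Q (lineShift c F) := by
  have key : polyShift (fun j => C (c j) * Q) = ((sigmaScale Q).restrictScalars K).comp (lineShift c) := by
    refine MvPolynomial.algHom_ext fun j => ?_
    simp only [AlgHom.comp_apply, AlgHom.restrictScalars_apply, polyShift_X, lineShift_X, map_add, map_mul, sigmaScale_C,
      sigmaScale_X]
    ring
  exact congrArg (fun φ : MvPolynomial ι K →ₐ[K] Polynomial (MvPolynomial ι K) => φ F) key

/-- Converse direction (ours): an invariant constant direction `c` makes every `Q·c` invariant. [cite: Lang2002, Ch. IV §1] -/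
theorem polyShift_eq_C_of_isInvariantDir {F : MvPolynomial ι K} {c : ι → K} (h : IsInvariantDir F c) (Q : MvPolynomial ι K) :
    polyShift (fun j => C (c j) * Q) F = Polynomial.C F := by
  rw [polyShift_C_mul, show lineShift c F = Polynomial.C F from h, sigmaScale_C]

/-- **T89 (a), LEMMA L core** (ours): over a domain, if `Q ≠ 0` and `G(X + t·Q·c) = G(X)` identically in `t`, then `c` is an
invariant direction of `G`: the `t^n`-coefficient of the hypothesis is `Q^n · h_n` with `h_n` the `n`-th Taylor coefficient of `G`
along `c`. [cite: Lang2002, Ch. IV §1] -/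
theorem isInvariantDir_of_polyShift_C_mul [NoZeroDivisors K] (c : ι → K) {Q : MvPolynomial ι K} (hQ : Q ≠ 0)
    {F : MvPolynomial ι K} (h : polyShift (fun j => C (c j) * Q) F = Polynomial.C F) : IsInvariantDir F c := by
  rw [polyShift_C_mul] at h
  unfold IsInvariantDir
  refine Polynomial.ext fun n => ?_
  have hn := Polynomial.ext_iff.mp h n
  rw [coeff_sigmaScale, Polynomial.coeff_C] at hn
  rw [Polynomial.coeff_C]
  rcases Nat.eq_zero_or_pos n with rfl | hpos
  · simpa using hn
  · rw [if_neg hpos.ne'] at hn ⊢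
    exact (mul_eq_zero.mp hn).resolve_left (pow_ne_zero n hQ)

/-- T89 (a) as an `iff` (ours). [cite: Lang2002, Ch. IV §1] -/
theorem isInvariantDir_iff_polyShift_C_mul [NoZeroDivisors K] (c : ι → K) {Q : MvPolynomial ι K} (hQ : Q ≠ 0)
    (F : MvPolynomial ι K) : IsInvariantDir F c ↔ polyShift (fun j => C (c j) * Q) F = Polynomial.C F :=
  ⟨fun h => polyShift_eq_C_of_isInvariantDir h Q, isInvariantDir_of_polyShift_C_mul c hQ⟩

/-- A coordinate polynomial direction `Q·e_i` is `C(e_i)·Q` (ours, plumbing). [cite: Lang2002, Ch. IV §1] -/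
theorem single_eq_C_mul [DecidableEq ι] (i : ι) (Q : MvPolynomial ι K) :
    (Pi.single i Q : ι → MvPolynomial ι K) = fun j => C ((Pi.single i (1 : K) : ι → K) j) * Q := by
  funext j
  by_cases hj : j = i
  · subst hj
    rw [Pi.single_eq_same, Pi.single_eq_same, C_1, one_mul]
  · rw [Pi.single_eq_of_ne hj, Pi.single_eq_of_ne hj, C_0, zero_mul]

/-- **T89 (a), coordinate form** (ours): over a domain, `Q ≠ 0` and `G(X + t·Q·e_i) = G` identically in `t` ⇒ `X_i` does not occur
in `G` (via `notMem_vars_of_isInvariantDir_single_one`; NO hypothesis `X_i ∉ Q.vars` is needed). [cite: Lang2002, Ch. IV §1] -/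
theorem notMem_vars_of_polyShift_single [DecidableEq ι] [NoZeroDivisors K] (F : MvPolynomial ι K) (i : ι)
    {Q : MvPolynomial ι K} (hQ : Q ≠ 0) (h : polyShift (Pi.single i Q) F = Polynomial.C F) : i ∉ F.vars := by
  rw [single_eq_C_mul] at h
  exact notMem_vars_of_isInvariantDir_single_one F i (isInvariantDir_of_polyShift_C_mul _ hQ h)

/-! ## T89 (b): the linear change of basis -/

section LinSubst

variable {L : Type*} [Field L] [Fintype ι] [DecidableEq ι]

/-- **T89 (b)** (ours): over a field, a NON-ZERO invariant constant direction `c` of `G` is straightened by an invertible linear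
substitution `A` with `i`-th column `c`, after which `X_i` is absent from `G∘A`. [cite: Lang2002, Ch. IV §1] -/
theorem exists_linSubst_notMem_vars (F : MvPolynomial ι L) {c : ι → L} (hc : c ≠ 0) (hF : IsInvariantDir F c) (i : ι) :
    ∃ A A' : Matrix ι ι L, A * A' = 1 ∧ A' * A = 1 ∧ (∀ r, A r i = c r) ∧ i ∉ (linSubst A F).vars := by
  obtain ⟨A, A', hAA', hA'A, hcol⟩ := exists_mul_eq_one_col_eq c hc i
  refine ⟨A, A', hAA', hA'A, hcol, ?_⟩
  rw [mem_vars_linSubst_iff A (linSubst_injective_of_mul_eq_one A A' hAA') F i, not_not]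
  rwa [show (fun j => A j i) = c from funext hcol]

/-- **T89 (a)+(b)** (ours): over a field, `c ≠ 0`, `Q ≠ 0`, `G(X + t·Q·c) = G` identically in `t` ⇒ an invertible linear change of
coordinates with `i`-th column `c` removes `X_i` from `G`. [cite: Lang2002, Ch. IV §1] -/
theorem exists_linSubst_notMem_vars_of_polyShift (F : MvPolynomial ι L) {c : ι → L} (hc : c ≠ 0) {Q : MvPolynomial ι L}
    (hQ : Q ≠ 0) (h : polyShift (fun j => C (c j) * Q) F = Polynomial.C F) (i : ι) :
    ∃ A A' : Matrix ι ι L, A * A' = 1 ∧ A' * A = 1 ∧ (∀ r, A r i = c r) ∧ i ∉ (linSubst A F).vars :=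
  exists_linSubst_notMem_vars F hc (isInvariantDir_of_polyShift_C_mul c hQ h) i

end LinSubst

/-! ## A worked instance -/

/-- Smoke test (ours): `G = X₀ − X₁` over `ℚ`, `Q = X₂²`, `c = (1, 1, 0)`: `G(X + tQc) = G`, so `c` is invariant — and indeed it is.
[cite: Lang2002, Ch. IV §1] -/
example : IsInvariantDir (X 0 - X 1 : MvPolynomial (Fin 3) ℚ) ![1, 1, 0] := by
  refine isInvariantDir_of_polyShift_C_mul (![1, 1, 0]) (Q := X 2 ^ 2) (pow_ne_zero 2 (X_ne_zero 2)) ?_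
  rw [map_sub, polyShift_X, polyShift_X, Polynomial.C_sub]
  simp
  
end PolyShift

end Literature.AlgebraicGeometry.Resolution.WeightedBlowup
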